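import Mathlib
import Summits.NavierStokesRegularity.NavierStokesRegularity.Theses.PlaneEnergyCeiling
import Summits.NavierStokesRegularity.NavierStokesRegularity.Theorems.PlaneEnergyCeilingPlanarEnergyAPrioriInitialCeiling
import Summits.NavierStokesRegularity.NavierStokesRegularity.Theorems.PlaneEnergyCeilingPlanarEnergyAPrioriDecayPersistence
import Summits.NavierStokesRegularity.NavierStokesRegularity.Theorems.PlaneEnergyCeilingPlanarEnergyAPrioriSlabLawMild

/-!
# Route PlaneEnergyCeiling · crux `PlanarEnergyAPriori` ⇐ the parabolic flux-convergence budget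

Helper file for the crux item stmt-NavierStokesRegularity-16855 (`PlanarEnergyAPriori`, route
`PlaneEnergyCeiling`), landed `--supports` that item. With the three provable stubs of the line
`Cruxes/PlanarEnergyAPriori/Lines/birth.lean` now LANDED —
`stub_initialPlanarCeiling` (p154875), `stub_decayPersistence` (p159857), `stub_slabLawMild`
(p161583) — the line's sorry-free composition becomes an importable REDUCTION THEOREM of the crux to
its single open piece, the parabolic flux-convergence budget (stub 4, verbatim as hypothesis):

  `FluxConvergenceBudget → PlanarEnergyAPriori`

(`planarEnergyAPriori_of_fluxConvergenceBudget`, concluding the route declaration BY NAME, and the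
registered expanded form `planarEnergyAPriori_of_fluxConvergenceBudget_expanded`). Proof = the
skeleton's composition: `M := M₀ + 2B`; at `t = 0` the initial ceiling; at `0 < t < T` restrict the
classical solution to `[0,t]`, feed the persisted decay into the mild slab law, bound
`sup_{c'} E(0;R,c') ≤ M₀` and the budget by `B`. Folklore bookkeeping; the mathematics is in the
three landed stubs.
-/

noncomputable section

-- single-conjunct summit: `Summit.<Summit>.<Problem>` repeats the name by the D-0017 layout
set_option linter.dupNamespace false

namespace Summit.NavierStokesRegularity.NavierStokesRegularity.Theorems.PlanarEnergyAPriori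

open MeasureTheory Set

/-- **The crux from the budget, registered expanded form** (sub-goal
`planarEnergyAPriori_of_fluxConvergenceBudget_expanded` of stmt-NavierStokesRegularity-16855): the
parabolic flux-convergence budget (stub 4 of the line `birth`, verbatim) implies the body of
`PlaneEnergyCeiling.PlanarEnergyAPriori` (verbatim). [folklore] -/
theorem planarEnergyAPriori_of_fluxConvergenceBudget_expanded : (∀ (ν T : ℝ), 0 < ν → 0 < T → ∀ (u : ℝ → EuclideanSpace ℝ (Fin 3) → EuclideanSpace ℝ (Fin 3)) (p : ℝ → EuclideanSpace ℝ (Fin 3) → ℝ), Literature.Analysis.FluidPDE.IsClassicalNSSolutionOn (Set.Ico 0 T) ν 0 u p → Literature.Analysis.FluidPDE.IsLerayHopfOn T ν 0 (u 0) u → Literature.Analysis.FluidPDE.HasRapidSpatialDecay (u 0) → ∃ B : ℝ, 0 ≤ B ∧ ∀ t ∈ Set.Ico 0 T, ∀ (R : EuclideanSpace ℝ (Fin 3) ≃ₗᵢ[ℝ] EuclideanSpace ℝ (Fin 3)), (∫⁻ s in Set.Ioo 0 t, ENNReal.ofReal ((Real.sqrt (Real.pi * ν * (t - s)))⁻¹)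 * (⨆ (a : ℝ) (b : ℝ), ‖(∫ y : EuclideanSpace ℝ (Fin 2), (‖u s (R (WithLp.toLp 2 ![y 0, y 1, a]))‖ ^ 2 / 2 + p s (R (WithLp.toLp 2 ![y 0, y 1, a]))) * inner ℝ (u s (R (WithLp.toLp 2 ![y 0, y 1, a]))) (R (EuclideanSpace.single 2 1))) - (∫ y : EuclideanSpace ℝ (Fin 2), (‖u s (R (WithLp.toLp 2 ![y 0, y 1, b]))‖ ^ 2 / 2 + p s (R (WithLp.toLp 2 ![y 0, y 1, b]))) * inner ℝ (u s (R (WithLp.toLp 2 ![y 0, y 1, b]))) (R (EuclideanSpace.single 2 1)))‖ₑ)) ≤ ENNReal.ofReal B) → ∀ (ν T : ℝ), 0 < ν → 0 < T → ∀ (u : ℝ → EuclideanSpace ℝ (Fin 3) → EuclideanSpace ℝ (Fin 3)) (p : ℝ → EuclideanSpace ℝ (Fin 3) → ℝ), Literature.Analysis.FluidPDE.IsClassicalNSSolutionOn (Set.Ico 0 T) ν 0 u p → Literature.Analysis.FluidPDE.IsLerayHopfOn T ν 0 (u 0) u → Literature.Analysis.FluidPDE.HasRapidSpatialDecay (u 0)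 → ∃ M : ℝ, ∀ t ∈ Set.Ico 0 T, ∀ (R : EuclideanSpace ℝ (Fin 3) ≃ₗᵢ[ℝ] EuclideanSpace ℝ (Fin 3)) (c : ℝ), ∫⁻ y : EuclideanSpace ℝ (Fin 2), ‖u t (R (WithLp.toLp 2 ![y 0, y 1, c]))‖ₑ ^ 2 ≤ ENNReal.ofReal M := by
  intro h₄
  have h₁ := stub_initialPlanarCeiling
  have h₂ := stub_decayPersistence
  have h₃ := stub_slabLawMild
  intro ν T hν hT u p hcl hLH hdec
  obtain ⟨M₀, hM₀, hinit⟩ := h₁ (u 0) hdec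
  obtain ⟨B, hB, hbud⟩ := h₄ ν T hν hT u p hcl hLH hdec
  refine ⟨M₀ + 2 * B, ?_⟩
  intro t ht R c
  have hsum : ENNReal.ofReal (M₀ + 2 * B) = ENNReal.ofReal M₀ + 2 * ENNReal.ofReal B := by
    rw [ENNReal.ofReal_add hM₀ (by positivity), ENNReal.ofReal_mul (by norm_num : (0 : ℝ) ≤ 2),
      ENNReal.ofReal_ofNat]
  rcases eq_or_lt_of_le ht.1 with h0 | htpos
  · -- the initial slice: the initial planar ceiling
    subst h0
    exact (hinit R c).trans (ENNReal.ofReal_le_ofReal (by linarith))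
  · -- a later slice: mild slab law on [0,t] + persisted decay + the budget
    have hcl' : Literature.Analysis.FluidPDE.IsClassicalNSSolutionOn (Set.Icc 0 t) ν 0 u p :=
      hcl.mono (Set.Icc_subset_Ico_right ht.2) (uniqueDiffOn_Icc htpos)
    have hdecay := h₂ ν T hν hT u p hcl hLH hdec t ht
    have hslab := h₃ ν t hν htpos u p hcl' hdecay R c
    refine hslab.trans ?_
    rw [hsum]
    gcongr
    · exact iSup_le fun c' => hinit R c'
    · exact hbud t ht R

/-- **`PlanarEnergyAPriori ⇐ FluxConvergenceBudget`, the route declaration BY NAME**: the crux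
`PlaneEnergyCeiling.PlanarEnergyAPriori` (stmt-NavierStokesRegularity-16855) follows from the
parabolic flux-convergence budget alone (stubs 1–3 of the line `birth` are theorems). [folklore] -/
theorem planarEnergyAPriori_of_fluxConvergenceBudget (h₄ : ∀ (ν T : ℝ), 0 < ν → 0 < T → ∀ (u : ℝ → EuclideanSpace ℝ (Fin 3) → EuclideanSpace ℝ (Fin 3)) (p : ℝ → EuclideanSpace ℝ (Fin 3) → ℝ), Literature.Analysis.FluidPDE.IsClassicalNSSolutionOn (Set.Ico 0 T) ν 0 u p → Literature.Analysis.FluidPDE.IsLerayHopfOn T ν 0 (u 0) u → Literature.Analysis.FluidPDE.HasRapidSpatialDecay (u 0) → ∃ B : ℝ, 0 ≤ B ∧ ∀ t ∈ Set.Ico 0 T, ∀ (R : EuclideanSpace ℝ (Fin 3) ≃ₗᵢ[ℝ] EuclideanSpace ℝ (Fin 3)), (∫⁻ s in Set.Ioo 0 t, ENNReal.ofReal ((Real.sqrt (Real.pi * ν * (t - s)))⁻¹) * (⨆ (a : ℝ) (b : ℝ), ‖(∫ y : EuclideanSpace ℝ (Fin 2), (‖u s (R (WithLp.toLp 2 ![y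 0, y 1, a]))‖ ^ 2 / 2 + p s (R (WithLp.toLp 2 ![y 0, y 1, a]))) * inner ℝ (u s (R (WithLp.toLp 2 ![y 0, y 1, a]))) (R (EuclideanSpace.single 2 1))) - (∫ y : EuclideanSpace ℝ (Fin 2), (‖u s (R (WithLp.toLp 2 ![y 0, y 1, b]))‖ ^ 2 / 2 + p s (R (WithLp.toLp 2 ![y 0, y 1, b]))) * inner ℝ (u s (R (WithLp.toLp 2 ![y 0, y 1, b]))) (R (EuclideanSpace.single 2 1)))‖ₑ)) ≤ ENNReal.ofReal B) :
    Summit.NavierStokesRegularity.NavierStokesRegularity.Theses.PlaneEnergyCeiling.PlanarEnergyAPriori :=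
  planarEnergyAPriori_of_fluxConvergenceBudget_expanded h₄

end Summit.NavierStokesRegularity.NavierStokesRegularity.Theorems.PlanarEnergyAPriori

end
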